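import Literature.MathematicalPhysics.QuantumFieldTheory.Balaban1983to89.B2Eq255RegionsWindow
import Literature.MathematicalPhysics.QuantumFieldTheory.Balaban1983to89.B2Eq324NestedRegions

/-!
# `Balaban1983to89.B2Eq243RegionsTower` — T. Bałaban, *(Higgs)₂,₃ quantum fields in a finite volume. II. An upper bound*,
Commun. Math. Phys. **86** (1982) 555–594 [Balaban1982Higgs2] p. 566 ((2.43), «admissible»), p. 570, p. 588 ((3.22)–(3.24)):
**the tower of small-field regions of ALL the steps, `Λ_i^{(j)} ⊂ T₁^{(j)}`, `j = 0, 1, …`, CONSTRUCTED on the concrete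
(Higgs)₂,₃ tori from the large-field points of each step** — step `1` on the whole lattice `T₁` ((2.7)–(2.8), gen 8), step
`j + 2` inside the window `Λ₇^{(j)′}` (p. 570, the typer's `B2Eq255RegionsWindow`) — and **p15's tower hypotheses
`B2Eq324NestedRegions.Tower` (`Λ₅^{(K)} = ∅`, unions of blocks, `B(Λ₅^{(j+1)}) ⊂ Λ₅^{(j)}`) DISCHARGED for it**, so that
(3.28) `eq328_tower` and the reduction `prop31_tower` of Proposition 3.1 hold for regions built from large-field data rather
than postulated; with the p. 566 admissibility conditions PROVED at every level

statement-level skeleton of published theorems with citation tags; proofs where landed; nothing here is a claim about the Yang–Mills mass gap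

PDF held: `paper:balaban1982-cmp86-higgs23-ii` (journal page = PDF page + 554); pp. 566 [PDF 12], 570 [PDF 16] READ AS IMAGES
on the ×2 renders `run/shared/lean/pub/pub-balaban/b2b-balaban-ref1/pages/1982-cmp86-higgs23-II/…-p012-x2.png`, `…-p016-x2.png`;
p. 588 [PDF 34] through p15's transcription in `B2Eq324NestedRegions`.

CITATION HEADER (lean-in-tree rule).  lit-balaban typed skeleton (HOME `run/shared/lean/pub/lit-balaban/`), typer line
(concrete carriers), gen 9, sequel of `B2Eq255RegionsWindow`.  SKELETON rows served: **B2.Eq2.43** ((2.43) + «admissible»,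
owner r02: the sums run over admissible `Λ₀^{(j)} ⊂ T₁^{(j)}` — the admissibility conditions at every level),
**B2.Eq2.55** (the region letters `Λ_i^{(k)}` of the `(k+1)`-st step), **B2.Eq3.25 / B2.Eq3.29** ((3.22)–(3.24)/(3.28): p15's
`Tower` INSTANTIATED — its HONEST SCOPE *"the construction (2.7)–(2.8)/(3.11)–(3.20) of the regions from the field
configurations is NOT formalized; the three structural properties it delivers are the hypotheses top/isUnion/nested"* is
discharged here for the deterministic part: large-field points ↦ regions), B2.Eq2.7.  NOTHING of record is restated: the
one-window construction IS `B2Eq255RegionsWindow.regionRel`, the first step IS gen-8's `B2Eq28RegionsConcrete.region`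
(`towerRegion_zero`), `Λ′` IS p15's `B2Eq324NestedRegions.prime`, the tower structure IS p15's `Tower`, and (3.28)/Prop. 3.1
are p15's `eq328_tower`/`prop31_tower` applied, not re-proved.

THE SOURCE TEXT.  p. 566 [PDF 12], verbatim: *"Z^ε ≦ ∫dA∫dφ Σ_{Λ₀^{(k−1)}⊂T₁^{(k−1)}, admissible} … Σ_{Λ₀^{(0)}⊂T₁, admissible}
ρ^{(k),Lᵏε}(Λ₀^{(0)}, …, Λ₀^{(k−1)}, A, θ_kA^{(k),ε}, φ) · … (2.43)  Here the word “admissible” means that the sets Λ₀^{(j)}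
have to satisfy all the conditions resulting from the construction. The sets are unions of big blocks, the set Λ₀^{(0)c} is
either empty or has at least one point whose distance from Λ₀^{(0)} is bigger than r(ε). In general Λ₀^{(j+1)} ⊂ Λ₇^{(j)′},
and either Λ₀^{(j+1)} is a maximal set composed of big blocks and satisfying this inclusion, or the set Λ₀^{(j+1)c} ∩ Λ₇^{(j)′}
has at least one point whose distance from Λ₀^{(j+1)} is bigger than r(L^{j+1}ε), and so on. Of course the sets Λ_i^{(j)}
are defined in the same way as Λ_i, r(ε) is replaced by r(Lʲε) only. Finally let us notice that Λ_i^{(j)} does not mean the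
prime operation applied j times to a set Λ_i, for different j these are independent sets."*  p. 570 [PDF 16]: *"Λ₀^{(k)} is
the sum of large blocks of the lattice T₁^{(k)} contained in Λ₇^{(k−1)′}, distant from the set B(P_v^{(k)})∪…∪R_s^{(k)} more
than r(Lᵏε)."*  p. 588 (3.23): *"where Λ₅^{(K)} = ∅."*

DICTIONARY (print ↦ Lean).  the large-field points of step `j + 1` (on `T₁^{(j)}`) ↦ `bad j : Set (Site P j)` (data; gen-8's
`badSites`/`B2Eq22LargeFieldSets` produce them from the six printed sets / a configuration); `r(Lʲε)` in lattice units of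
`T₁^{(j)}` ↦ `r j`; `Λ_i^{(j)}` ↦ `towerRegion bad r j i`; the window of step `j + 1` ↦ `window bad r j` (`= T₁` for `j = 0`,
`= (Λ₇^{(j−1)})′ = prime (towerRegion bad r (j−1) 7)` after); p15's `Tower P K` ↦ `towerOf bad r hr K` with
`lam j = Λ₅^{(j)}` for `j < K` and `lam K = ∅` (the printed convention (3.23)).

WHAT THIS FILE PROVES (0 sorry; standard axioms; definitions with bodies + theorems; no `Prop`-valued definition).
§1 the recursion: `towerRegion_zero` (step 1 = gen-8's `region`), `towerRegion_succ`/`towerRegion_eq` (step `j+2` =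
   `regionRel` in the window `(Λ₇^{(j)})′`), `window_zero`/`window_succ`.
§2 per level, BY NAME from the window file: unions of large blocks / of blocks (`towerRegion_blockOf_congr`), nested in `i`,
   **`towerRegion_succ_subset_prime`** (*"In general Λ₀^{(j+1)} ⊂ Λ₇^{(j)′}"*, every `i`), **`mem_of_blockOf_mem_succ`**
   (`B(Λ_i^{(j+1)}) ⊂ Λ₇^{(j)} ⊂ Λ_{i′}^{(j)}`, `i′ ≤ 7` — the cross-level nesting), separations `sep_towerRegion`,
   `sep_towerRegion_bad`, `sep_towerRegion_window`, `towerRegion_eq_univ_of_no_bad` (non-vacuity: no large field ⇒ every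
   `Λ_i^{(j)} = T₁^{(j)}`).
§3 **`towerOf`**: p15's `B2Eq324NestedRegions.Tower P K` with `top`, `isUnion`, `nested` PROVED for the constructed regions;
   `towerOf_lam_of_lt`/`towerOf_lam_of_not_lt`; hence **`eq328_constructed`** ((3.28)) and **`prop31_constructed`** (Prop. 3.1
   reduced to (3.29)) = p15's theorems for the constructed tower.
§4 admissibility at every level: **`admissible_towerRegion_zero`** (gen-8's `admissible_zero` transported) and
   **`admissible_towerRegion_succ`** (the general clause, from `B2Eq255RegionsWindow.admissible_rel`, for large-field points
   inside the window).
HONEST SCOPE.  (a) Which points are bad at each step is data (the characteristic functions of (2.4)–(2.6)/(2.53) and the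
fields `Ā^{(k)}`, `φ^{(k)}` decide it); the value here is the deterministic geometry downstream of it, across all levels.
(b) `Λ₅^{(K)} = ∅` is the printed CONVENTION of (3.23) (the last step has no further small-field region), implemented by
`lam K := ∅`; levels `j > K` are likewise `∅` and unused.  (c) Thresholds as in gen 8 (`≥ r` where the print says *"more
than"*/*"bigger than"*, see `B2Eq255RegionsWindow` HONEST SCOPE (b)).  (d) No field, no measure, no estimate beyond p15's two
theorems applied; NOT summit progress.  Unit `lit-balaban-typer` gen 9 (literature-prover-lit-balaban-typer-g9-0);
HOME/FILED.md records the proposal.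
-/

noncomputable section

open scoped BigOperators

namespace Literature.MathematicalPhysics.QuantumFieldTheory.Balaban1983to89.B2Eq243RegionsTower

open HiggsLattice HiggsRescaling B2Eq28RegionsConcrete B2Eq255RegionsWindow
open B2Eq324NestedRegions (prime mem_prime Tower eq328_tower prop31_tower)
open B1Ineq234LevelZero (tdist_comm)

variable {P : HiggsLattice.Params}

/-! ## §1 The recursion over the steps: `Λ_i^{(0)}` on `T₁`, `Λ_i^{(j+1)}` inside `(Λ₇^{(j)})′` -/

section Recursion

/-- **The regions of all the steps**, `Λ_i^{(j)} ⊂ T₁^{(j)}`: at `j = 0` the regions (2.7)–(2.8) of the first step on the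
whole lattice, at `j + 1` the p. 570 regions inside the window `Λ₇^{(j)′}` (*"for different j these are independent sets"*,
p. 566 — built from the step's own large-field points `bad j` and radius `r j`). [cite: Balaban1982Higgs2, (2.43) p.566] -/
def towerRegion (bad : (j : ℕ) → Set (HiggsLattice.Site P j)) (r : ℕ → ℝ) : (j : ℕ) → ℕ → Finset (HiggsLattice.Site P j)
  | 0 => fun i => regionRel Finset.univ (bad 0) (r 0) i
  | j + 1 => fun i => regionRel (prime (towerRegion bad r j 7)) (bad (j + 1)) (r (j + 1)) i

/-- **The window of step `j + 1`**: `T₁` for the first step, `Λ₇^{(j−1)′}` afterwards (p. 570: the new restrictions are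
*"considered on the set Λ₇^{(k−1)′}"*). [cite: Balaban1982Higgs2, (2.55) p.570] -/
def window (bad : (j : ℕ) → Set (HiggsLattice.Site P j)) (r : ℕ → ℝ) : (j : ℕ) → Finset (HiggsLattice.Site P j)
  | 0 => Finset.univ
  | j + 1 => prime (towerRegion bad r j 7)

variable {bad : (j : ℕ) → Set (HiggsLattice.Site P j)} {r : ℕ → ℝ}

/-- **Step 1 is gen-8's construction**: `Λ_i^{(0)} = Λ_i` of (2.7)–(2.8) on `T₁`. [cite: Balaban1982Higgs2, (2.7)–(2.8) p.558] -/
theorem towerRegion_zero (i : ℕ) : towerRegion bad r 0 i = region (bad 0) (r 0) i :=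
  regionRel_univ (bad 0) (r 0) i

/-- Step `j + 2` is the p. 570 construction inside `Λ₇^{(j)′}`. [cite: Balaban1982Higgs2, (2.55) p.570] -/
theorem towerRegion_succ (j i : ℕ) :
    towerRegion bad r (j + 1) i = regionRel (prime (towerRegion bad r j 7)) (bad (j + 1)) (r (j + 1)) i := rfl

/-- The window of the first step is the whole lattice. [cite: Balaban1982Higgs2, (2.7) p.558] -/
theorem window_zero : window bad r 0 = (Finset.univ : Finset (HiggsLattice.Site P 0)) := rfl

/-- The window of step `j + 2` is `Λ₇^{(j)′}`. [cite: Balaban1982Higgs2, (2.55) p.570] -/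
theorem window_succ (j : ℕ) : window bad r (j + 1) = prime (towerRegion bad r j 7) := rfl

/-- Uniformly in `j`: `Λ_i^{(j)}` is the relative construction inside the step's window. [cite: Balaban1982Higgs2, (2.43) p.566] -/
theorem towerRegion_eq : ∀ (j i : ℕ), towerRegion bad r j i = regionRel (window bad r j) (bad j) (r j) i
  | 0, _ => rfl
  | _ + 1, _ => rfl

end Recursion

/-! ## §2 Per-level properties, and the cross-level nesting `B(Λ_i^{(j+1)}) ⊂ Λ₇^{(j)}` -/

section Levels

variable {bad : (j : ℕ) → Set (HiggsLattice.Site P j)} {r : ℕ → ℝ}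

/-- `Λ_i^{(j)}` is a union of large blocks of `T₁^{(j)}` (*"The sets are unions of big blocks"*). [cite: Balaban1982Higgs2, (2.43) p.566] -/
theorem towerRegion_isUnionOfLargeBlocks (j i : ℕ) : IsUnionOfLargeBlocks (towerRegion bad r j i) := by
  rw [towerRegion_eq]
  exact regionRel_isUnionOfLargeBlocks _ _ _ _

/-- `Λ_i^{(j)}` is a union of blocks, in the shape of p15's `Tower.isUnion`. [cite: Balaban1982Higgs2, (3.22) p.588] -/
theorem towerRegion_blockOf_congr (j i : ℕ) {x x' : HiggsLattice.Site P j} (hb : HiggsLattice.blockOf x = HiggsLattice.blockOf x') :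
    x ∈ towerRegion bad r j i ↔ x' ∈ towerRegion bad r j i := by
  rw [towerRegion_eq]
  exact regionRel_blockOf_congr _ _ _ _ hb

/-- Within one step the regions are nested: `Λ_{i′}^{(j)} ⊆ Λ_i^{(j)}` for `i ≤ i′` (`r(Lʲε) ≥ 0`). [cite: Balaban1982Higgs2, (2.8) p.558] -/
theorem towerRegion_antitone {j : ℕ} (hr : 0 ≤ r j) {i i' : ℕ} (h : i ≤ i') : towerRegion bad r j i' ⊆ towerRegion bad r j i := by
  rw [towerRegion_eq, towerRegion_eq]
  exact regionRel_antitone hr h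

/-- `Λ_i^{(j)}` lies in the step's window. [cite: Balaban1982Higgs2, (2.43) p.566] -/
theorem towerRegion_subset_window {j : ℕ} (hr : 0 ≤ r j) (i : ℕ) : towerRegion bad r j i ⊆ window bad r j := by
  rw [towerRegion_eq]
  exact regionRel_subset_window hr i

/-- **p. 566: *"In general Λ₀^{(j+1)} ⊂ Λ₇^{(j)′}"*** — and with it every `Λ_i^{(j+1)}`. [cite: Balaban1982Higgs2, (2.43) p.566] -/
theorem towerRegion_succ_subset_prime {j : ℕ} (hr : 0 ≤ r (j + 1)) (i : ℕ) :
    towerRegion bad r (j + 1) i ⊆ prime (towerRegion bad r j 7) :=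
  towerRegion_subset_window (j := j + 1) hr i

/-- **The cross-level nesting**: if the block of `x ∈ T₁^{(j)}` lies in `Λ_i^{(j+1)}` then `x ∈ Λ₇^{(j)}`
(`Λ_i^{(j+1)} ⊂ Λ₇^{(j)′}` and `y ∈ Λ′ ⇔ B(y) ⊂ Λ`). [cite: Balaban1982Higgs2, (3.22) p.588] -/
theorem mem_seven_of_blockOf_mem_succ {j : ℕ} (hr : 0 ≤ r (j + 1)) {i : ℕ} {x : HiggsLattice.Site P j}
    (hx : HiggsLattice.blockOf x ∈ towerRegion bad r (j + 1) i) : x ∈ towerRegion bad r j 7 :=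
  (mem_prime _ _).mp (towerRegion_succ_subset_prime hr i hx) x rfl

/-- Hence `B(Λ_i^{(j+1)}) ⊂ Λ_{i′}^{(j)}` for every `i′ ≤ 7` — in particular `B(Λ₅^{(j+1)}) ⊂ Λ₅^{(j)}`, p15's `Tower.nested`.
[cite: Balaban1982Higgs2, (3.22) p.588] -/
theorem mem_of_blockOf_mem_succ {j : ℕ} (hr : 0 ≤ r j) (hr' : 0 ≤ r (j + 1)) {i i' : ℕ} (hi' : i' ≤ 7)
    {x : HiggsLattice.Site P j} (hx : HiggsLattice.blockOf x ∈ towerRegion bad r (j + 1) i) : x ∈ towerRegion bad r j i' :=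
  towerRegion_antitone hr hi' (mem_seven_of_blockOf_mem_succ hr' hx)

/-- As an inclusion of finite sets: `B(Λ_i^{(j+1)}) ⊆ Λ₇^{(j)}` (`HiggsLattice.blockSet` = the operation `B(·)` of (I.1.18)).
[cite: Balaban1982Higgs2, (3.22) p.588] -/
theorem blockSet_towerRegion_succ_subset {j : ℕ} (hr : 0 ≤ r (j + 1)) (i : ℕ) :
    HiggsLattice.blockSet (towerRegion bad r (j + 1) i) ⊆ towerRegion bad r j 7 := fun x hx =>
  mem_seven_of_blockOf_mem_succ hr ((HiggsLattice.mem_blockSet _ x).mp hx)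

/-- Separation within a step: `x ∈ Λ_{i′}^{(j)}`, `y ∉ Λ_i^{(j)}`, `i < i′` ⇒ `r(Lʲε) < |x − y|`. [cite: Balaban1982Higgs2, (2.8) p.558] -/
theorem sep_towerRegion {j : ℕ} (hr : 0 ≤ r j) {i i' : ℕ} (h : i < i') {x y : HiggsLattice.Site P j}
    (hx : x ∈ towerRegion bad r j i') (hy : y ∉ towerRegion bad r j i) : r j < (HiggsLattice.Site.tdist x y : ℝ) := by
  rw [towerRegion_eq] at hx hy
  exact sep_regionRel hr h hx hy

/-- Separation from the step's large fields: `x ∈ Λ_i^{(j)}`, `z` bad ⇒ `r(Lʲε) ≤ |x − z|`. [cite: Balaban1982Higgs2, (2.7) p.558] -/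
theorem sep_towerRegion_bad {j : ℕ} (hr : 0 ≤ r j) (i : ℕ) {x z : HiggsLattice.Site P j} (hx : x ∈ towerRegion bad r j i)
    (hz : z ∈ bad j) : r j ≤ (HiggsLattice.Site.tdist x z : ℝ) := by
  rw [towerRegion_eq] at hx
  exact sep_bad_rel hr i hx hz

/-- Separation from the outside of the window: `x ∈ Λ_{i+1}^{(j+1)}`, `y ∉ Λ₇^{(j)′}` ⇒ `r(L^{j+1}ε) < |x − y|`.
[cite: Balaban1982Higgs2, (2.55) p.570] -/
theorem sep_towerRegion_window {j : ℕ} (hr : 0 ≤ r (j + 1)) (i : ℕ) {x y : HiggsLattice.Site P (j + 1)}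
    (hx : x ∈ towerRegion bad r (j + 1) (i + 1)) (hy : y ∉ prime (towerRegion bad r j 7)) :
    r (j + 1) < (HiggsLattice.Site.tdist x y : ℝ) :=
  sep_window hr i hx hy

/-- The large-field points of a step lie outside all its regions (`r(Lʲε) > 0`). [cite: Balaban1982Higgs2, (2.7) p.558] -/
theorem not_mem_towerRegion_of_bad {j : ℕ} (hr : 0 < r j) (i : ℕ) {z : HiggsLattice.Site P j} (hz : z ∈ bad j) :
    z ∉ towerRegion bad r j i := by
  rw [towerRegion_eq]
  exact not_mem_regionRel_of_bad hr i hz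

/-- p. 558/570: no large-field point of the step within distance `< r(Lʲε)` of `Λ_i^{(j)}`. [cite: Balaban1982Higgs2, (2.8) p.558] -/
theorem not_bad_of_mem_near_towerRegion {j : ℕ} (hr : 0 ≤ r j) (i : ℕ) {y : HiggsLattice.Site P j}
    (hy : y ∈ near (towerRegion bad r j i) (r j)) : y ∉ bad j := by
  rw [towerRegion_eq] at hy
  exact not_bad_of_mem_near_regionRel hr i hy

/-- `(T₁^{(j)})′ = T₁^{(j+1)}`: the prime of the whole lattice is the whole coarse lattice. [cite: Balaban1982Higgs2, (3.22) p.588] -/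
theorem prime_univ (j : ℕ) : prime (Finset.univ : Finset (HiggsLattice.Site P j)) = Finset.univ := by
  ext y
  simp only [Finset.mem_univ, mem_prime, implies_true]

/-- **Non-vacuity**: with no large field at any step, every `Λ_i^{(j)}` is the whole lattice `T₁^{(j)}`.
[cite: Balaban1982Higgs2, (2.43) p.566] -/
theorem towerRegion_eq_univ_of_no_bad (h : ∀ j, bad j = ∅) : ∀ (j i : ℕ), towerRegion bad r j i = Finset.univ
  | 0, i => by rw [towerRegion_zero, h 0, region_eq_univ_of_bad_empty]
  | j + 1, i => by rw [towerRegion_succ, towerRegion_eq_univ_of_no_bad h j 7, prime_univ, h (j + 1), regionRel_eq_univ]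

end Levels

/-! ## §3 p15's `Tower` INSTANTIATED: (3.28) and the reduction of Prop. 3.1 for the constructed regions -/

section TowerSection

variable (bad : (j : ℕ) → Set (HiggsLattice.Site P j)) (r : ℕ → ℝ) (hr : ∀ j, 0 ≤ r j)

/-- **The tower of §3 built from the large-field data**: `Λ₅^{(j)} = towerRegion bad r j 5` for `j < K`, and the printed
convention *"Λ₅^{(K)} = ∅"* of (3.23) (levels `≥ K` carry `∅`); p15's three structural hypotheses PROVED: `top` by the
convention, `isUnion` = `towerRegion_blockOf_congr`, `nested` = `mem_of_blockOf_mem_succ` (`B(Λ₅^{(j+1)}) ⊂ Λ₇^{(j)} ⊂ Λ₅^{(j)}`).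
[cite: Balaban1982Higgs2, (3.22)–(3.24) p.588] -/
def towerOf (K : ℕ) : Tower P K where
  lam j := if j < K then towerRegion bad r j 5 else ∅
  top := by rw [if_neg (lt_irrefl K)]
  isUnion j hj x x' h := by
    rw [if_pos hj]
    exact towerRegion_blockOf_congr j 5 h
  nested j hj x hx := by
    rw [if_pos hj]
    by_cases hj1 : j + 1 < K
    · rw [if_pos hj1] at hx
      exact mem_of_blockOf_mem_succ (hr j) (hr (j + 1)) (by norm_num) hx
    · rw [if_neg hj1] at hx
      exact absurd hx (Finset.notMem_empty _)

variable {bad r hr}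

/-- The levels below `K` of the tower are the constructed `Λ₅^{(j)}`. [cite: Balaban1982Higgs2, (3.22) p.588] -/
theorem towerOf_lam_of_lt {K j : ℕ} (hj : j < K) : (towerOf bad r hr K).lam j = towerRegion bad r j 5 := if_pos hj

/-- The levels `≥ K` are empty (*"Λ₅^{(K)} = ∅"*). [cite: Balaban1982Higgs2, (3.23) p.588] -/
theorem towerOf_lam_of_not_lt {K j : ℕ} (hj : ¬ j < K) : (towerOf bad r hr K).lam j = ∅ := if_neg hj

open B2Eq337ScalarIntegration B2Eq325ConcreteSchur B2Ineq327ConcreteNeumann B2Eq328ConcretePieces in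
/-- **(3.28) for the regions CONSTRUCTED from the large-field data** (p15's `eq328_tower` for `towerOf`).
[cite: Balaban1982Higgs2, (3.28) p.589] -/
theorem eq328_constructed (K : ℕ) {N : ℕ} (C : ChargeData N) {a : ℝ} (A : HiggsLattice.VecField P 0) {msq : ℝ}
    (ha : 0 < a) (hL : 1 < P.L) (hmsq : 0 ≤ msq) (Φ : Cfg (towerOf bad r hr K).regions N) :
    form325N (towerOf bad r hr K).regions C a (towerOf bad r hr K).nested_regions.pieces A msq Φ
      = outTerm (towerOf bad r hr K).regions C A msq Φ.1
        + ∑ j, termForm (towerOf bad r hr K).regions C a A msq j (resL (towerOf bad r hr K).regions j Φ) :=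
  eq328_tower (towerOf bad r hr K) C A ha hL hmsq Φ

open B2Eq337ScalarIntegration B2Eq325ConcreteSchur B2Ineq327ConcreteNeumann B2Eq328ConcretePieces in
/-- **Proposition 3.1 (3.26) reduced to (3.29) for the regions CONSTRUCTED from the large-field data** (p15's `prop31_tower`
for `towerOf`; (3.29) per scale stays the hypothesis `h329`). [cite: Balaban1982Higgs2, Prop. 3.1 (3.26) p.589] -/
theorem prop31_constructed (K : ℕ) {N : ℕ} (C : ChargeData N) {a : ℝ} (A : HiggsLattice.VecField P 0) {msq : ℝ}
    (ha : 0 < a) (hL : 1 < P.L) (hmsq : 0 < msq) {γ₀ : ℝ} (hγ₁ : γ₀ ≤ 1)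
    (bond mass : (j : Fin K) → (LSite (towerOf bad r hr K).regions j → V N) → ℝ) (err : Fin K → ℝ)
    (h329 : ∀ (j : Fin K) (ψ : LSite (towerOf bad r hr K).regions j → V N),
      γ₀ * (bond j ψ + mass j ψ) - err j ≤ termForm (towerOf bad r hr K).regions C a A msq j ψ)
    (Φ : Cfg (towerOf bad r hr K).regions N) :
    γ₀ * (bond0 (towerOf bad r hr K).regions C A Φ.1 + ∑ j, bond j (resL (towerOf bad r hr K).regions j Φ))
        + γ₀ * (mass0 (towerOf bad r hr K).regions msq Φ.1 + ∑ j, mass j (resL (towerOf bad r hr K).regions j Φ))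
        - ∑ j, err j
      ≤ form325 (towerOf bad r hr K).regions C a A msq Φ :=
  prop31_tower (towerOf bad r hr K) C A ha hL hmsq hγ₁ bond mass err h329 Φ

end TowerSection

/-! ## §4 p. 566: admissibility at every level, PROVED for the constructed tower -/

section Admissible

variable {bad : (j : ℕ) → Set (HiggsLattice.Site P j)} {r : ℕ → ℝ}

/-- **Level `0`** (*"the set Λ₀^{(0)c} is either empty or has at least one point whose distance from Λ₀^{(0)} is bigger than
r(ε)"*): gen-8's `admissible_zero` for `Λ₀^{(0)} = towerRegion bad r 0 0`. [cite: Balaban1982Higgs2, (2.43) p.566] -/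
theorem admissible_towerRegion_zero (hr : 0 < r 0) :
    (towerRegion bad r 0 0)ᶜ = ∅ ∨
      ∃ z ∈ (towerRegion bad r 0 0)ᶜ, ∀ x ∈ towerRegion bad r 0 0, r 0 ≤ (HiggsLattice.Site.tdist z x : ℝ) := by
  rw [towerRegion_zero]
  exact admissible_zero hr

/-- **Level `j + 1`** (*"In general Λ₀^{(j+1)} ⊂ Λ₇^{(j)′}, and either Λ₀^{(j+1)} is a maximal set composed of big blocks and
satisfying this inclusion, or the set Λ₀^{(j+1)c} ∩ Λ₇^{(j)′} has at least one point whose distance from Λ₀^{(j+1)} is bigger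
than r(L^{j+1}ε)"*), for large-field points inside the window (p. 570: they arise from restrictions *"considered on the set
Λ₇^{(k−1)′}"*): `Λ₀^{(j+1)}` is a union of large blocks, lies in `Λ₇^{(j)′}`, and the dichotomy holds (with `≥`).
[cite: Balaban1982Higgs2, (2.43) p.566] -/
theorem admissible_towerRegion_succ {j : ℕ} (hr : 0 < r (j + 1))
    (hbad : bad (j + 1) ⊆ ↑(prime (towerRegion bad r j 7))) :
    IsUnionOfLargeBlocks (towerRegion bad r (j + 1) 0) ∧
      towerRegion bad r (j + 1) 0 ⊆ prime (towerRegion bad r j 7) ∧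
      (towerRegion bad r (j + 1) 0 = inLB (prime (towerRegion bad r j 7)) ∨
        ∃ z ∈ prime (towerRegion bad r j 7), z ∉ towerRegion bad r (j + 1) 0 ∧
          ∀ x ∈ towerRegion bad r (j + 1) 0, r (j + 1) ≤ (HiggsLattice.Site.tdist z x : ℝ)) :=
  admissible_rel_full hr hbad

/-- The maximal alternative characterised: `Λ₀^{(j+1)} = inLB (Λ₇^{(j)′})` as soon as no large block inside the window is
within `< r` of a large-field point (in particular when step `j + 2` has no large field). [cite: Balaban1982Higgs2, (2.43) p.566] -/
theorem towerRegion_succ_zero_eq_inLB {j : ℕ}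
    (h : ∀ x ∈ inLB (prime (towerRegion bad r j 7)), ∀ z ∈ bad (j + 1), r (j + 1) ≤ lbDist x z) :
    towerRegion bad r (j + 1) 0 = inLB (prime (towerRegion bad r j 7)) :=
  regionRel_zero_eq_inLB_of_far h

end Admissible

end Literature.MathematicalPhysics.QuantumFieldTheory.Balaban1983to89.B2Eq243RegionsTower
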